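import Summits.NavierStokesRegularity.NavierStokesRegularity.Theorems.RootDecompLiouvilleHorizonLadderTop
import HarnessLib

/-!
# Route `RootDecompLiouvilleHorizon` (N22): `Assembly` (item stmt-NavierStokesRegularity-32034) — closing link

The proof is `Theorems.RootDecompLiouvilleHorizonLadderTop.rootDecompLiouvilleHorizon_assembly_proof`
(lens-5 g22 «LADDER TOP», landed with workitem stmt-NavierStokesRegularity-32322); this file is the by-name
closing link for the route's `Assembly` item (the implication (L) → B♯ → E♯ → NavierStokesRegularity, i.e.
the node's composed deciding theorem with Q♭ ⟸ (L) by `blowupHorizon_of_typeIliouvilleL`, G by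
`typeIGradientFloor_proof`, K1/K2 by the landed kills). An implication-shaped item: closing it closes
neither (L) stmt-NavierStokesRegularity-10661 nor E♯ stmt-NavierStokesRegularity-32033 nor the summit.
-/

set_option linter.dupNamespace false

namespace Summit.NavierStokesRegularity.NavierStokesRegularity.Theorems.RootDecompLiouvilleHorizonAssembly

/-- **`Assembly` of route `RootDecompLiouvilleHorizon`, item stmt-NavierStokesRegularity-32034**: PROVED
(`RootDecompLiouvilleHorizonLadderTop.rootDecompLiouvilleHorizon_assembly_proof`).
[cite: KochNadirashviliSereginSverak2009, §6] -/
theorem assembly_holds :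
    Summit.NavierStokesRegularity.NavierStokesRegularity.Theses.RootDecompLiouvilleHorizon.Assembly :=
  RootDecompLiouvilleHorizonLadderTop.rootDecompLiouvilleHorizon_assembly_proof

end Summit.NavierStokesRegularity.NavierStokesRegularity.Theorems.RootDecompLiouvilleHorizonAssembly
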